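import Summits.Parity.BatemanHorn.Theorems.SelbergDelangeRigidityLSDRealSegmentTailsTwoAPriori
import Summits.Parity.BatemanHorn.Theorems.SelbergDelangeRigidityLSDRealSegmentTailsTwoHarmonic
import HarnessLib

/-!
# Route `SelbergDelangeRigidity`, crux `LSDRealSegment` (stmt-Parity-9770), line
# `product-anatomy-subcritical`: ingredients of clause (b) of `stub_tailsTwo` (Rankin's trick through the engine)

Clause (b) (`RankinTail`) bounds the tilted mass of the `n ≤ x` for which the `x^θ`-smooth part of some value
`fᵢ(n)` exceeds `x^τ`.  Either the `P`-smooth part of that value exceeds `x^{τ/2}` — a union of slices `s` with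
`sᵢ > x^{τ/2}`, negligible by the engine because the smooth harmonic series has small tails — or the MIDDLE part
(primes in `(P, x^θ]`) exceeds `x^{τ/2}`, and Rankin's trick `1 ≤ (mid/x^{τ/2})^σ`, `σ = 1/(θ log x)`, turns the
class sum into an engine sum with the RANKIN WEIGHT `F(N) = y^{Ω(r)} (smoothPart z r)^σ`, `r = roughPart P N`,
`z = x^θ` — of class `𝓜(3y, 1, ε)` once `P^{ε/2} ≥ y`, `σ ≤ ε/2`, `σ log z ≤ 1` (`tailsTwo_rankinWeight_isClassM`,
registered helper).  Also here: the generic dyadic assembly below a fixed `x` (`sum_Icc_le_of_blocks`).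
-/

open Filter Finset Polynomial
open scoped BigOperators Topology Classical

namespace Summit.Parity.BatemanHorn.Cruxes.LSDRealSegment.ProductAnatomySubcritical

open Literature.NumberTheory.Sieve
open ArithmeticFunction (cardFactors)
noncomputable section

variable {k : ℕ}

/-! ### Dyadic assembly below a fixed height -/

/-- **Dyadic assembly below `x`**: if every block `(X, 2X]` with `M ≤ X ≤ x` has `w`-mass `≤ E X` (`w, E ≥ 0`, `M ≥ 1`),
then `Σ_{n ≤ N} w(n) ≤ Σ_{n ≤ 2M} w(n) + 2 E N` for every `N ≤ x`. [folklore] -/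
theorem sum_Icc_le_of_blocks {w : ℕ → ℝ} (hw : ∀ n, 0 ≤ w n) {E : ℝ} (hE : 0 ≤ E) {M x : ℕ} (hM : 1 ≤ M)
    (hblk : ∀ X : ℕ, M ≤ X → X ≤ x → ∑ n ∈ Finset.Ioc X (2 * X), w n ≤ E * X) :
    ∀ N : ℕ, N ≤ x → ∑ n ∈ Finset.Icc 1 N, w n ≤ (∑ n ∈ Finset.Icc 1 (2 * M), w n) + 2 * E * N := by
  intro N
  induction N using Nat.strong_induction_on with
  | _ N ih =>
    intro hNx
    rcases le_or_gt N (2 * M) with hN | hN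
    · calc ∑ n ∈ Finset.Icc 1 N, w n ≤ ∑ n ∈ Finset.Icc 1 (2 * M), w n :=
            Finset.sum_le_sum_of_subset_of_nonneg (Finset.Icc_subset_Icc_right hN) fun n _ _ => hw n
        _ ≤ _ := by nlinarith [Nat.cast_nonneg (α := ℝ) N]
    · set X : ℕ := (N + 1) / 2 with hX
      have hXN : X < N := by omega
      have hMX : M ≤ X := by omega
      have hXx : X ≤ x := by omega
      have hN2X : N ≤ 2 * X := by omega
      have hsplit : ∑ n ∈ Finset.Icc 1 N, w n = ∑ n ∈ Finset.Icc 1 X, w n + ∑ n ∈ Finset.Ioc X N, w n := by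
        have h1 : Finset.Icc 1 N = Finset.Icc 1 X ∪ Finset.Ioc X N := by
          ext n; simp only [Finset.mem_union, Finset.mem_Icc, Finset.mem_Ioc]; omega
        rw [h1, Finset.sum_union]
        rw [Finset.disjoint_left]
        intro n h1 h2
        rw [Finset.mem_Icc] at h1
        rw [Finset.mem_Ioc] at h2
        omega
      have hblock : ∑ n ∈ Finset.Ioc X N, w n ≤ E * X :=
        (Finset.sum_le_sum_of_subset_of_nonneg (Finset.Ioc_subset_Ioc_right hN2X) fun n _ _ => hw n).trans (hblk X hMX hXx)
      have hXr : 3 * (X : ℝ) ≤ 2 * N := by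
        have : 3 * X ≤ 2 * N := by omega
        exact_mod_cast this
      rw [hsplit]
      calc ∑ n ∈ Finset.Icc 1 X, w n + ∑ n ∈ Finset.Ioc X N, w n
          ≤ ((∑ n ∈ Finset.Icc 1 (2 * M), w n) + 2 * E * X) + E * X := add_le_add (ih X hXN hXx) hblock
        _ ≤ (∑ n ∈ Finset.Icc 1 (2 * M), w n) + 2 * E * N := by nlinarith

/-! ### The Rankin weight -/

/-- The smooth part of a divisor divides the smooth part. [folklore] -/
theorem smoothPart_dvd_smoothPart (z : ℝ) {a m : ℕ} (ham : a ∣ m) (hm : m ≠ 0) : smoothPart z a ∣ smoothPart z m := by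
  have ha : a ≠ 0 := fun h => hm (Nat.eq_zero_of_zero_dvd (h ▸ ham))
  rw [← Nat.factorization_le_iff_dvd (smoothPart_ne_zero z a) (smoothPart_ne_zero z m)]
  intro p
  rw [factorization_smoothPart, factorization_smoothPart]
  split_ifs
  · exact (Nat.factorization_le_iff_dvd ha hm).mpr ham p
  · exact le_rfl

/-- The rough part divides the number. [folklore] -/
theorem roughPart_dvd (z : ℝ) (m : ℕ) : roughPart z m ∣ m := by
  rcases eq_or_ne m 0 with rfl | hm
  · exact dvd_zero _
  · exact Dvd.intro_left _ (smoothPart_mul_roughPart z hm)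

/-- The `z`-smooth part splits over the `P`-smooth / `P`-rough factorisation, and the first factor is at most the
`P`-smooth part: `smoothPart z v ≤ smoothPart P v · smoothPart z (roughPart P v)`. [folklore] -/
theorem smoothPart_le_smoothPart_mul_mid (z : ℝ) (P : ℕ) {v : ℕ} (hv : v ≠ 0) :
    (smoothPart z v : ℝ) ≤ (smoothPart (P : ℝ) v : ℝ) * smoothPart z (roughPart (P : ℝ) v) := by
  have h := smoothPart_mul z (smoothPart_ne_zero (P : ℝ) v) (roughPart_ne_zero (P : ℝ) v)
  rw [smoothPart_mul_roughPart _ hv] at h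
  rw [h, Nat.cast_mul]
  exact mul_le_mul_of_nonneg_right (by exact_mod_cast smoothPart_le z (smoothPart_ne_zero _ _)) (Nat.cast_nonneg _)

/-- The Rankin weight is dominated by the plain Rankin tilt: `y^{Ω(r)} (smoothPart z r)^σ ≤ y^{Ω(m)} (smoothPart z m)^σ`,
`r = roughPart P m` (`y ≥ 1`, `σ ≥ 0`). [folklore] -/
theorem rankinWeight_le {y σ z : ℝ} (hy : 1 ≤ y) (hσ : 0 ≤ σ) (P m : ℕ) :
    y ^ cardFactors (roughPart (P : ℝ) m) * (smoothPart z (roughPart (P : ℝ) m) : ℝ) ^ σ ≤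
      y ^ cardFactors m * (smoothPart z m : ℝ) ^ σ := by
  rcases eq_or_ne m 0 with rfl | hm
  · simp [roughPart]
  have h1 : cardFactors (roughPart (P : ℝ) m) ≤ cardFactors m := by
    rw [roughPart_eq_div _ hm]
    exact cardFactors_div_smoothPart_le _ hm
  have h2 : (smoothPart z (roughPart (P : ℝ) m) : ℝ) ≤ smoothPart z m := by
    exact_mod_cast Nat.le_of_dvd (Nat.pos_of_ne_zero (smoothPart_ne_zero z m))
      (smoothPart_dvd_smoothPart z (roughPart_dvd _ m) hm)
  exact mul_le_mul (pow_le_pow_right₀ hy h1) (Real.rpow_le_rpow (Nat.cast_nonneg _) h2 hσ) (by positivity) (by positivity)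

/-- **tailsTwo_rankinWeight_isClassM** (registered helper of `stub_tailsTwo`, line `product-anatomy-subcritical`): the
Rankin weight `N ↦ y^{Ω(r)} (smoothPart z r)^σ`, `r = roughPart P N`, lies in the Nair–Tenenbaum class `𝓜(3y, 1, ε)` when
`1 ≤ y ≤ P^{ε/2}`, `0 ≤ σ ≤ ε/2` and `σ log z ≤ 1` (`p^σ ≤ e ≤ 3` on `p ≤ z`; `y^{Ω(r)} ≤ r^{ε/2}`, `s^σ ≤ r^{ε/2}`);
it depends only on the `P`-rough part and equals `1` at `1`. [folklore] -/
theorem tailsTwo_rankinWeight_isClassM : ∀ (y ε z σ : ℝ) (P : ℕ), 1 ≤ y → 0 < ε → 1 ≤ P → y ≤ (P : ℝ) ^ (ε / 2) →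
    0 ≤ σ → σ ≤ ε / 2 → σ * Real.log z ≤ 1 →
    IsClassM (3 * y) 1 ε (fun N => y ^ cardFactors (roughPart (P : ℝ) N) * (smoothPart z (roughPart (P : ℝ) N) : ℝ) ^ σ) ∧
    (∀ N, y ^ cardFactors (roughPart (P : ℝ) N) * (smoothPart z (roughPart (P : ℝ) N) : ℝ) ^ σ =
      y ^ cardFactors (roughPart (P : ℝ) (roughPart (P : ℝ) N)) *
        (smoothPart z (roughPart (P : ℝ) (roughPart (P : ℝ) N)) : ℝ) ^ σ) ∧
    y ^ cardFactors (roughPart (P : ℝ) 1) * (smoothPart z (roughPart (P : ℝ) 1) : ℝ) ^ σ ≤ 1 := by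
  intro y ε z σ P hy hε hP hyP hσ hσε hσz
  have hy0 : 0 ≤ y := by linarith
  have hP0 : (0 : ℝ) ≤ P := Nat.cast_nonneg P
  set F : ℕ → ℝ := fun N => y ^ cardFactors (roughPart (P : ℝ) N) * (smoothPart z (roughPart (P : ℝ) N) : ℝ) ^ σ with hF
  -- the plain Rankin tilt `G` on the rough part
  set G : ℕ → ℝ := fun m => y ^ cardFactors m * (smoothPart z m : ℝ) ^ σ with hG
  have hGdef : ∀ m, G m = y ^ cardFactors m * (smoothPart z m : ℝ) ^ σ := fun _ => rfl
  have hFG : ∀ N, F N = G (roughPart (P : ℝ) N) := fun _ => rfl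
  refine ⟨isClassM_of_mul_of_le (fun N => by positivity) ?_ ?_ ?_, fun N => by rw [roughPart_roughPart], by simp [roughPart]⟩
  · -- multiplicativity
    intro m n hmn
    rcases eq_or_ne m 0 with rfl | hm
    · obtain rfl : n = 1 := by simpa using hmn
      simp [hF, roughPart]
    rcases eq_or_ne n 0 with rfl | hn
    · obtain rfl : m = 1 := by simpa using hmn
      simp [hF, roughPart]
    rw [hFG, hFG, hFG, roughPart_mul _ hm hn]
    exact tilt_mul_of_coprime hGdef (Nat.Coprime.coprime_dvd_left (roughPart_dvd _ m)
      (Nat.Coprime.coprime_dvd_right (roughPart_dvd _ n) hmn))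
  · -- `F(m) ≤ (3y)^{Ω(m)}`: `G(p^ν) = G(p)^ν`, `G(p) ≤ e y ≤ 3 y`
    intro m hm
    have hm0 : m ≠ 0 := by omega
    rw [hFG]
    set r := roughPart (P : ℝ) m with hr
    have hr0 : r ≠ 0 := roughPart_ne_zero _ _
    -- `G(r) ≤ (3y)^{Ω(r)}` by induction over the factorisation
    have key : ∀ r : ℕ, r ≠ 0 → G r ≤ (3 * y) ^ cardFactors r := by
      refine Nat.recOnPosPrimePosCoprime ?_ (fun h => (h rfl).elim) (fun _ => by rw [tilt_one hGdef]; simp) ?_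
      · intro p ν hp _ _
        rw [tilt_prime_pow hGdef hp, ArithmeticFunction.cardFactors_apply_prime_pow hp]
        refine pow_le_pow_left₀ (tilt_nonneg hGdef hy0 p) ((tilt_prime_le hGdef hy0 hσ hσz hp).trans ?_) ν
        have he : Real.exp 1 ≤ 3 := by
          have := Real.exp_one_lt_d9; linarith
        nlinarith
      · intro a b ha hb hab iha ihb _
        rw [tilt_mul_of_coprime hGdef hab, ArithmeticFunction.cardFactors_mul (by omega) (by omega), pow_add]
        exact mul_le_mul (iha (by omega)) (ihb (by omega)) (tilt_nonneg hGdef hy0 b) (pow_nonneg (by linarith) _)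
    refine (key r hr0).trans (pow_le_pow_right₀ (by linarith) ?_)
    rw [hr, roughPart_eq_div _ hm0]
    exact cardFactors_div_smoothPart_le _ hm0
  · -- `F(m) ≤ m^ε`: `y^{Ω(r)} ≤ (P^{ε/2})^{Ω(r)} ≤ r^{ε/2}` and `(smoothPart z r)^σ ≤ r^σ ≤ r^{ε/2}`
    intro m hm
    have hm0 : m ≠ 0 := by omega
    rw [hFG, one_mul]
    set r := roughPart (P : ℝ) m with hr
    have hr0 : r ≠ 0 := roughPart_ne_zero _ _
    have hr1 : (1 : ℝ) ≤ r := by exact_mod_cast Nat.one_le_iff_ne_zero.mpr hr0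
    have hrm : (r : ℝ) ≤ m := by exact_mod_cast Nat.le_of_dvd (by omega) (roughPart_dvd _ m)
    have h1 : y ^ cardFactors r ≤ (r : ℝ) ^ (ε / 2) := by
      calc y ^ cardFactors r ≤ ((P : ℝ) ^ (ε / 2)) ^ cardFactors r := pow_le_pow_left₀ hy0 hyP _
        _ = ((P : ℝ) ^ cardFactors r) ^ (ε / 2) := by
            rw [← Real.rpow_natCast, ← Real.rpow_mul hP0, mul_comm, Real.rpow_mul hP0, Real.rpow_natCast]
        _ ≤ (r : ℝ) ^ (ε / 2) := Real.rpow_le_rpow (by positivity)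
            (pow_cardFactors_le_self hP0 hr0 fun q hq hqr => (lt_of_mem_primeFactors_roughPart
              (Nat.mem_primeFactors.mpr ⟨hq, hqr, hr0⟩)).le) (by linarith)
    have h2 : (smoothPart z r : ℝ) ^ σ ≤ (r : ℝ) ^ (ε / 2) :=
      calc (smoothPart z r : ℝ) ^ σ ≤ (r : ℝ) ^ σ :=
            Real.rpow_le_rpow (Nat.cast_nonneg _) (by exact_mod_cast smoothPart_le z hr0) hσ
        _ ≤ (r : ℝ) ^ (ε / 2) := Real.rpow_le_rpow_of_exponent_le hr1 hσε
    calc G r = y ^ cardFactors r * (smoothPart z r : ℝ) ^ σ := rfl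
      _ ≤ (r : ℝ) ^ (ε / 2) * (r : ℝ) ^ (ε / 2) := mul_le_mul h1 h2 (by positivity) (by positivity)
      _ = (r : ℝ) ^ ε := by rw [← Real.rpow_add (by linarith)]; ring_nf
      _ ≤ ((m : ℕ) : ℝ) ^ ε := Real.rpow_le_rpow (by positivity) hrm hε.le

end

end Summit.Parity.BatemanHorn.Cruxes.LSDRealSegment.ProductAnatomySubcritical
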